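import Literature.Geometry.Riemannian.RicciFlowLengthDistortion
import HarnessLib

/-!
# Approximate intermediate points of the Riemannian distance

The Riemannian distance `d = g.edist hg` of a Riemannian metric (`RiemannianDistance.lean`, an
infimum of lengths of `C¹` curves) is a length (pseudo-)distance; in particular it has approximate
intermediate points: if `d(x, z) < a + b` with `a, b > 0` then some `y` has `d(x, y) < a` and
`d(y, z) < b`. This elementary fact (O'Neill 1983, Ch. 5, Def. 15 and Prop. 18; Burago–Burago–
Ivanov 2001, §2.4) is what chains of overlapping balls along an almost minimising curve rest on;
it is used to chain the local comparison of conventional and `P*`-parabolic neighbourhoods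
(Bamler 2020a, Cor. 9.6) in space.

* `exists_edist_lt_edist_lt_of_edist_lt_add` — the statement. Proof: an almost minimising `C¹`
  curve `γ` from `x` to `z` of length `L < a + b` (`Manifold.exists_lt_of_riemannianEDist_lt`);
  if `d(x, z) < a` take `y = z`; otherwise the continuous function `s ↦ d(x, γ s)` takes a value
  `v` with `L − b < v < a` at some `s ∈ [0, 1]` (intermediate value theorem), and then
  `d(γ s, z) ≤ L(γ|[s,1]) = L − L(γ|[0,s]) ≤ L − d(x, γ s) < b`.

Everything is proved; no definitions, no named facts.

## References

* B. O'Neill, *Semi-Riemannian Geometry*, Academic Press 1983, Ch. 5, Def. 15, Prop. 18.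
  [ONeill1983]
* R. H. Bamler, *Entropy and heat kernel bounds on a Ricci flow background*, arXiv:2008.07093
  (2020), §9.1, Cor. 9.6. [Bamler2020Entropy]
-/

noncomputable section

open Bundle Set Filter Function MeasureTheory Manifold
open scoped Manifold ContDiff Topology ENNReal NNReal

namespace Literature.Geometry.Riemannian

open Lorentzian Lorentzian.PseudoRiemannianMetric

variable {E : Type*} [NormedAddCommGroup E] [NormedSpace ℝ E] [FiniteDimensional ℝ E]
  {H : Type*} [TopologicalSpace H] {I : ModelWithCorners ℝ E H}
  {M : Type*} [TopologicalSpace M] [ChartedSpace H M] [IsManifold I ∞ M] [T3Space M]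
  {g : PseudoRiemannianMetric I ∞ E (TangentSpace I : M → Type _)}

/-- **Approximate intermediate points of the Riemannian distance**: if `d(x, z) < a + b` with
`a, b > 0`, then there is `y` with `d(x, y) < a` and `d(y, z) < b` (the distance is an infimum of
lengths of curves: split an almost minimising curve where `d(x, γ s)` crosses a value between
`L − b` and `a`). [cite: ONeill1983, Ch. 5, Def. 15 (p. 134) and Prop. 18] -/
theorem exists_edist_lt_edist_lt_of_edist_lt_add (hg : g.IsRiemannian) (x z : M) {a b : ℝ}
    (ha : 0 < a) (hb : 0 < b) (h : g.edist hg x z < ENNReal.ofReal (a + b)) :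
    ∃ y : M, g.edist hg x y < ENNReal.ofReal a ∧ g.edist hg y z < ENNReal.ofReal b := by
  -- the trivial case `d(x, z) < a`
  by_cases hxz : g.edist hg x z < ENNReal.ofReal a
  · exact ⟨z, hxz, by rw [PseudoRiemannianMetric.edist_self]; exact ENNReal.ofReal_pos.2 hb⟩
  rw [not_lt] at hxz
  -- an almost minimising curve
  letI := g.riemannianBundle hg
  obtain ⟨γ, hγ0, hγ1, hγs, hlen⟩ := exists_lt_of_riemannianEDist_lt (I := I) (x := x) (y := z) h
  have hlen' : g.length hg γ 0 1 < ENNReal.ofReal (a + b) := hlen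
  have hLtop : g.length hg γ 0 1 ≠ ⊤ := (hlen'.trans ENNReal.ofReal_lt_top).ne
  set L : ℝ := (g.length hg γ 0 1).toReal with hL
  have hLab : L < a + b := ENNReal.toReal_lt_of_lt_ofReal hlen'
  -- lengths of sub-arcs
  have hsplit : ∀ s ∈ Icc (0 : ℝ) 1,
      g.length hg γ 0 s + g.length hg γ s 1 = g.length hg γ 0 1 := fun s hs ↦
    pathELength_add hs.1 hs.2
  have hfin0 : ∀ s ∈ Icc (0 : ℝ) 1, g.length hg γ 0 s ≠ ⊤ := fun s hs ↦
    ne_top_of_le_ne_top hLtop ((hsplit s hs) ▸ le_self_add)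
  have hfin1 : ∀ s ∈ Icc (0 : ℝ) 1, g.length hg γ s 1 ≠ ⊤ := fun s hs ↦
    ne_top_of_le_ne_top hLtop ((hsplit s hs) ▸ le_add_self)
  have hdist0 : ∀ s ∈ Icc (0 : ℝ) 1, g.edist hg x (γ s) ≤ g.length hg γ 0 s := fun s hs ↦ by
    rw [← hγ0]
    exact edist_le_length hg hs.1 (hγs.mono (Icc_subset_Icc le_rfl hs.2))
  have hdfin : ∀ s ∈ Icc (0 : ℝ) 1, g.edist hg x (γ s) ≠ ⊤ := fun s hs ↦
    ne_top_of_le_ne_top (hfin0 s hs) (hdist0 s hs)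
  -- the continuous function `φ(s) = d(x, γ s)`
  set φ : ℝ → ℝ := fun s ↦ (g.edist hg x (γ s)).toReal with hφ
  have hφc : ContinuousOn φ (Icc 0 1) := by
    have h1 : ContinuousOn (fun s ↦ g.edist hg x (γ s)) (Icc 0 1) :=
      (PseudoRiemannianMetric.continuous_edist hg).comp_continuousOn
        (continuousOn_const.prodMk hγs.continuousOn)
    exact ENNReal.continuousOn_toReal.comp h1 fun s hs ↦ hdfin s hs
  have hφ0 : φ 0 = 0 := by simp only [hφ, hγ0, PseudoRiemannianMetric.edist_self,
    ENNReal.toReal_zero]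
  have hφ1 : a ≤ φ 1 := by
    simp only [hφ, hγ1]
    exact (ENNReal.ofReal_le_iff_le_toReal (hγ1 ▸ hdfin 1 ⟨zero_le_one, le_rfl⟩)).1 hxz
  -- the intermediate value `v`, `max (L - b) 0 < v < a`
  set v : ℝ := (max (L - b) 0 + a) / 2 with hv
  have hmax : max (L - b) 0 < a := max_lt (by linarith) ha
  have hva : v < a := by rw [hv]; linarith
  have hvb : L - b < v := by
    have := le_max_left (L - b) 0
    rw [hv]; linarith
  have hv0 : 0 ≤ v := by
    have := le_max_right (L - b) 0
    rw [hv]; linarith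
  obtain ⟨s, hs, hφs⟩ : ∃ s ∈ Icc (0 : ℝ) 1, φ s = v :=
    intermediate_value_Icc zero_le_one hφc ⟨by rw [hφ0]; exact hv0, hva.le.trans hφ1⟩
  refine ⟨γ s, ?_, ?_⟩
  · -- `d(x, γ s) = v < a`
    rw [← ENNReal.ofReal_toReal (hdfin s hs)]
    have hlt : (g.edist hg x (γ s)).toReal < a := by
      change φ s < a
      rw [hφs]; exact hva
    exact (ENNReal.ofReal_lt_ofReal_iff ha).2 hlt
  · -- `d(γ s, z) ≤ L(γ|[s,1]) = L − L(γ|[0,s]) ≤ L − v < b`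
    have h1 : g.edist hg (γ s) z ≤ g.length hg γ s 1 := by
      rw [← hγ1]
      exact edist_le_length hg hs.2 (hγs.mono (Icc_subset_Icc hs.1 le_rfl))
    have h2 : (g.length hg γ s 1).toReal = L - (g.length hg γ 0 s).toReal := by
      rw [hL, ← hsplit s hs, ENNReal.toReal_add (hfin0 s hs) (hfin1 s hs)]
      ring
    have h3 : v ≤ (g.length hg γ 0 s).toReal := by
      rw [← hφs]
      exact ENNReal.toReal_mono (hfin0 s hs) (hdist0 s hs)
    have h4 : (g.length hg γ s 1).toReal < b := by rw [h2]; linarith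
    exact h1.trans_lt ((ENNReal.lt_ofReal_iff_toReal_lt (hfin1 s hs)).2 h4)

end Literature.Geometry.Riemannian

end
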